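import Summits.ResolutionOfSingularities.ResolutionOfSingularities.Theorems.FrobeniusLadderFInjectiveMacaulayficationSigma5P2d4CNewtonKFanTables
import Summits.ResolutionOfSingularities.ResolutionOfSingularities.Theorems.FrobeniusLadderFInjectiveMacaulayficationFanCheckChunks
import HarnessLib

/-!
# KERNEL CHECKS (fan side) of the class-route cover data for f′ = σ₅(f_P2d4C): shapes, (hgen), unimodularity, vertex bridge, pure powers, (hAJ), the vertex property (hge),
# the local-matrix bridge `hVq` and the NEWTON MINIMISER check — each ONE `decide +kernel` on the tables of `Sigma5P2d4CNewtonKFanTables`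
# (crux `FInjectiveMacaulayfication` stmt-ResolutionOfSingularities-15315, chain w45a; (W-WND) class-route retro-fit PILOT, res-L1-w45a-plan-1 R22.4 (3); seat res-L1-w45a-stub-2 g11)

Support file for crux stmt-ResolutionOfSingularities-15315 (`FrobeniusLadder.FInjectiveMacaulayfication`), chain w45a.
[OURS · L1 W4.5a] — NOT a statement of any manuscript; AI-written, weaker than expert review.

The Boolean checks of res-L1-w45a-stub-4's `FanCheckKit` (+ res-L1-w45a-stub-2's `FanCheckMulti` / `FanCheckChunks`) on the class-route data of `f′ = z²+x⁴z+x⁹+x¹⁰+y³+u³+t³` (char 2;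
the `Σ_f′ ∧ Σ(𝔪)` fan `sig5_fan.json` 4f24f39fd1d306c2, 55 charts, centre `𝔪·K` with `|K| = 157`, 785 generators; certificate `sig5_cover.json` sha16 86a530aef7d8e6b6): `checkShapes` (no exceptional
vectors, `r = 0`), `CL.length = 55`, `checkHgen`, `checkDetUnit`, `FanCheckMulti.checkMVBridge`, `checkHprim`, `checkHAJ`, the length check of `KL2`, the vertex property `checkHge`
(one pass), the bridge `Vq c = chartV 5 RAYS CL 55 c`, and the NEWTON MINIMISER check (`U0 c ∈ SUPPv` minimises every row functional of `Vq c` over `SUPPv` — the fan refines `Σ_f′`).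
The cover records are checked in `Sigma5P2d4CNewtonKCoverChecks`; the binders are `Sigma5P2d4CNewtonKFan`. No definitions, no named facts. [folklore; cite: CoxLittleSchenck2011, §2.3]
-/

-- single-problem summit: the doubled namespace component is forced
set_option linter.dupNamespace false

namespace Summit.ResolutionOfSingularities.ResolutionOfSingularities.Theorems.FInjectiveMacaulayfication.Sigma5P2d4CNewtonKFan

open Summit.ResolutionOfSingularities.ResolutionOfSingularities.Theorems.FInjectiveMacaulayfication
open FanCheckKit FanCheckSound

/-! ## Light checks (ONE `decide` each; bundled with `CL.length = 55`, which keeps every statement distinct from the sibling fan modules) -/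

/-- (tlen, shapes, lengths of `K`'s table): light fan-side checks I. -/
theorem fan_checks_a : CL.length = 55 ∧ checkShapes 5 0 AL2 RAYS CL = true ∧ (KL2.all fun ch => allLen 5 ch) = true := by
  decide +kernel

/-- (tlen, hgen, hV, vertex bridge): light fan-side checks II. -/
theorem fan_checks_b : CL.length = 55 ∧ checkHgen 5 AL2 RAYS CL = true ∧ checkDetUnit 5 RAYS CL VinvTL = true ∧
    FanCheckMulti.checkMVBridge 5 AL2 MV2 50 55 CL = true := by
  decide +kernel

/-- (tlen, hprim, hAJ): light fan-side checks III. -/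
theorem fan_checks_c : CL.length = 55 ∧ checkHprim 5 AL2 PJ = true ∧ checkHAJ AL2 = true := by
  decide +kernel

/-- 55 charts. -/
theorem tlen : CL.length = 55 := fan_checks_a.1

/-- (shapes) lengths and index bounds of all tables. -/
theorem shapes : checkShapes 5 0 AL2 RAYS CL = true ∧ CL.length = 55 := ⟨fan_checks_a.2.1, tlen⟩

/-- (hgen) `V c · a c i = V c · m c + e_i`. -/
theorem check_hgen : checkHgen 5 AL2 RAYS CL = true ∧ CL.length = 55 := ⟨fan_checks_b.2.1, tlen⟩

/-- (hV) `V c · W c = 1` over `ℤ`. -/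
theorem check_det : checkDetUnit 5 RAYS CL VinvTL = true ∧ CL.length = 55 := ⟨fan_checks_b.2.2.1, tlen⟩

/-- The vertex table `MV2` agrees with the chart records. -/
theorem check_mvbridge : FanCheckMulti.checkMVBridge 5 AL2 MV2 50 55 CL = true := fan_checks_b.2.2.2

/-- (hprim) pure powers of all five variables among the generators. -/
theorem check_hprim : checkHprim 5 AL2 PJ = true ∧ CL.length = 55 := ⟨fan_checks_c.2.1, tlen⟩

/-- (hAJ) no generator is `0`. -/
theorem check_hAJ : checkHAJ AL2 = true ∧ CL.length = 55 := ⟨fan_checks_c.2.2, tlen⟩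

/-- Every chunk of `K`'s table consists of vectors of length 5. -/
theorem check_klen : (KL2.all fun ch => allLen 5 ch) = true ∧ CL.length = 55 := ⟨fan_checks_a.2.2, tlen⟩

/-! ## (hge) the vertex property, one pass (785 generators × 16 rays) -/

/-- ★ (hge) the vertex property on all 16 rays (with the specimen-distinct conjunct `CL.length = 55`). -/
theorem check_hge : checkHge AL2 RAYS CL = true ∧ CL.length = 55 := ⟨by decide +kernel, tlen⟩

/-! ## The Newton side: local matrices and minimisers -/

/-- The local matrix table agrees with `chartV 5 RAYS CL 55`. -/
theorem hVq : ∀ c : Fin 55, Vq c = chartV 5 RAYS CL 55 c := by decide +kernel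

/-- Every Newton minimiser is a support vector of `f′`. -/
theorem hU0_mem : ∀ c : Fin 55, U0 c ∈ SUPPv := by decide +kernel

/-- ★ THE NEWTON MINIMISER CHECK (the fan refines `Σ_f′`): on every chart, `U0 c` minimises every row functional of `Vq c` over the support of `f′` (explicit dot products). -/
theorem hmin_raw : ∀ c : Fin 55, ∀ i : Fin 5, ∀ u ∈ SUPPv,
    Vq c i 0 * U0 c 0 + Vq c i 1 * U0 c 1 + Vq c i 2 * U0 c 2 + Vq c i 3 * U0 c 3 + Vq c i 4 * U0 c 4 ≤
      Vq c i 0 * u 0 + Vq c i 1 * u 1 + Vq c i 2 * u 2 + Vq c i 3 * u 3 + Vq c i 4 * u 4 := by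
  decide +kernel

/-- The pure powers `x_j^(N_j)` in `K`, as a membership check on the flattened table — so `𝔪 ⊆ √K`. -/
theorem hKpow : (Pi.single 0 110 : Fin 5 → ℕ) ∈ KL2.flatten.map (vecOf 5) ∧ (Pi.single 1 41 : Fin 5 → ℕ) ∈ KL2.flatten.map (vecOf 5) ∧ (Pi.single 2 41 : Fin 5 → ℕ) ∈ KL2.flatten.map (vecOf 5) ∧ (Pi.single 3 41 : Fin 5 → ℕ) ∈ KL2.flatten.map (vecOf 5) ∧ (Pi.single 4 26 : Fin 5 → ℕ) ∈ KL2.flatten.map (vecOf 5) ∧ CL.length = 55 := by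
  refine ⟨?_, ?_, ?_, ?_, ?_, tlen⟩ <;> decide +kernel

end Summit.ResolutionOfSingularities.ResolutionOfSingularities.Theorems.FInjectiveMacaulayfication.Sigma5P2d4CNewtonKFan
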